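import Mathlib
import Summits.MatrixMultiplication.MatrixMultiplication.Theorems.SubgroupIdentityDesigns.Negative.LinearCharacterLevel

/-!
# Rank-one triangular configurations: the identity-test level of `1 + 𝔫` is at least its triangle number
(negative lemma, crux `SubgroupIdentityDesigns`, stmt-MatrixMultiplication-14079; cell B2b-5, gen 4)

`Negative.LinearCharacterLevel` reduced "no level-`k` identity test on a set `S ⊇ 1 + 𝔫`" to exhibiting an
additive form `λ` on `𝔫 = T(M_m(𝔽_p))` whose affine dual coset `{M : tr(M · n) = λ(n) ∀ n ∈ 𝔫}` contains no
matrix of rank `≤ k`, and gave the instance of a transposed `(k+1) × (k+1)` GRID inside a position set.  Here the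
grid is relaxed to a TRIANGLE, which is the natural generality of the argument and unifies the two earlier filters:

* `succ_le_rank_of_rankOneTriangle` — a RANK-ONE TRIANGULAR CONFIGURATION of size `k + 1` for `(𝔫, λ)`:
  vectors `u_j, v_i ∈ 𝔽_p^m` with `u_j v_iᵀ ∈ 𝔫` and `λ(u_j v_iᵀ) = [i = j]` for all `i ≤ j` (nothing is asked
  for `i > j`).  Then every `M` on the affine dual coset has `(V M U)_{ij} = v_iᵀ M u_j = [i = j]` for `i ≤ j`,
  i.e. `V M U` is lower unitriangular, so `rk M ≥ rk (V M U) = k + 1`.  `𝔫` need not be a pattern algebra, nor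
  closed under multiplication. [folklore linear algebra; the use is new]
* `no_idTest_of_rankOneTriangle` — hence no level-`k` identity test on any `S ⊇ {1 + T e}`.
* `succ_le_rank_of_triCoset` / `no_idTest_of_patTriangle` — the pattern instance: a position set `Pos`
  containing a TRANSPOSED `(k+1)`-TRIANGLE `{(γ j, ρ i) : i ≤ j}` (`ρ, γ` injective), with the same form
  `λ(n) = Σ_l n_{γ l, ρ l}` as for the grid; every coset point has `M.submatrix ρ γ` lower unitriangular.
* `no_levelK_design_of_patTriangle` (strictly lower `Pos`) / `no_levelK_design_of_patTriangleUpper` (strictly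
  upper `Pos`) — the crux-language DESIGN FILTER: if `H₁ ≤ GL_m(𝔽_p)` contains every unipotent supported on such a
  `Pos`, then `(H₁, H₂, H₃)` has no level-`k` identity design, for all `H₂, H₃` and every prime `p`.
* `no_levelK_design_of_lowerUnitriangular` / `no_levelK_design_of_upperUnitriangular` — COROLLARY: the full
  unitriangular group with `m ≥ k + 2` contains the transposed staircase `ρ i = i, γ j = j + 1` (resp. its
  reverse), so `Negative.UnitriangularLevel`'s filter (`H₁ ⊇ U_m`, `m ≥ k + 2`) and `Negative.LinearCharacterLevel`'s
  grid filter are both instances of the one triangle criterion.  More instances: every parabolic unipotent radical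
  `U_{(m₁,…,m_t)}` and every NESTED (chain-graph) pattern contains a transposed triangle of size its staircase
  number `max {r : μ_a ≥ r + 1 − a, a ≤ r}` (`μ` = sorted row lengths of the transposed pattern).
NOT SHARP in general: a census of all bipartite patterns (gen-4 certificates `exceptions_5x5.json`) finds `5 × 5`
position sets with triangle number `2` whose level-`2` identity test nevertheless fails — four over every `𝔽_p`
(a chain of forced parallel rows), one over `𝔽_2` only (four forced directions in a plane, `|P¹(𝔽_2)| = 3`): the
identity-test level of a pattern group is a genuine, `p`-dependent minimal-rank completion invariant.
Sorry-free; standard axioms.  VALUE = theorem (a filter for design searches), NOT summit progress.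
-/

set_option linter.dupNamespace false

noncomputable section

open scoped BigOperators Classical

namespace Summit.MatrixMultiplication.MatrixMultiplication.Theorems.SubgroupIdentityDesigns.Negative

variable {p m : ℕ} [Fact p.Prime]

/-- A square matrix with `1` on the diagonal and `0` above it has full rank (whatever is below). [folklore] -/
theorem rank_eq_of_unitLower {n : ℕ} (N : Matrix (Fin n) (Fin n) (ZMod p))
    (hdiag : ∀ i, N i i = 1) (hupper : ∀ i j, i < j → N i j = 0) : N.rank = n := by
  have htri : N.BlockTriangular OrderDual.toDual := by
    intro i j hlt
    have hlt' : i < j := by simpa using hlt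
    exact hupper i j hlt'
  have hdet : N.det = 1 := by
    rw [Matrix.det_of_lowerTriangular _ htri]
    exact Finset.prod_eq_one fun i _ => hdiag i
  have hunit : IsUnit N := by
    rw [Matrix.isUnit_iff_isUnit_det, hdet]
    exact isUnit_one
  rw [Matrix.rank_of_isUnit N hunit, Fintype.card_fin]

/-- `tr(M · x yᵀ) = yᵀ M x`, written as a double sum. [folklore] -/
theorem trace_mul_vecMulVec_eq_sum (M : CMat p m) (x y : Fin m → ZMod p) :
    Matrix.trace (M * Matrix.vecMulVec x y) = ∑ a : Fin m, ∑ b : Fin m, y a * M a b * x b := by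
  simp only [Matrix.trace, Matrix.diag_apply, Matrix.mul_apply, Matrix.vecMulVec_apply]
  exact Finset.sum_congr rfl fun a _ => Finset.sum_congr rfl fun b _ => by ring

/-- **RANK-ONE TRIANGULAR CONFIGURATION ⇒ NO RANK-`≤ k` POINT ON THE AFFINE DUAL COSET.**  If for all
`i ≤ j ≤ k` the rank-one matrix `u_j v_iᵀ` lies in `𝔫 = T(M_m)` with `λ(u_j v_iᵀ) = [i = j]`, then every `M` with
`tr(M · n) = λ(n)` on `𝔫` has rank `≥ k + 1` (`V M U` is lower unitriangular). -/
theorem succ_le_rank_of_rankOneTriangle {k : ℕ} (T : CMat p m →+ CMat p m) (lam : CMat p m →+ ZMod p)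
    (u v : Fin (k + 1) → Fin m → ZMod p)
    (hconf : ∀ i j : Fin (k + 1), i ≤ j → ∃ e : CMat p m,
      T e = Matrix.vecMulVec (u j) (v i) ∧ lam (T e) = if i = j then 1 else 0)
    (M : CMat p m) (hM : ∀ e : CMat p m, Matrix.trace (M * T e) = lam (T e)) :
    k + 1 ≤ M.rank := by
  have hVMU : ∀ i j : Fin (k + 1),
      ((Matrix.of fun i a => v i a : Matrix (Fin (k + 1)) (Fin m) (ZMod p)) * M *
        (Matrix.of fun a j => u j a : Matrix (Fin m) (Fin (k + 1)) (ZMod p))) i j =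
        ∑ a : Fin m, ∑ b : Fin m, v i a * M a b * u j b := by
    intro i j
    simp only [Matrix.mul_apply, Matrix.of_apply, Finset.sum_mul]
    rw [Finset.sum_comm]
  have hN : ∀ i j : Fin (k + 1), i ≤ j →
      ((Matrix.of fun i a => v i a : Matrix (Fin (k + 1)) (Fin m) (ZMod p)) * M *
        (Matrix.of fun a j => u j a : Matrix (Fin m) (Fin (k + 1)) (ZMod p))) i j =
        if i = j then 1 else 0 := by
    intro i j hij
    obtain ⟨e, hTe, hle⟩ := hconf i j hij
    have h := hM e
    rw [hle, hTe, trace_mul_vecMulVec_eq_sum] at h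
    rw [hVMU, h]
  have hrk : ((Matrix.of fun i a => v i a : Matrix (Fin (k + 1)) (Fin m) (ZMod p)) * M *
        (Matrix.of fun a j => u j a : Matrix (Fin m) (Fin (k + 1)) (ZMod p))).rank = k + 1 :=
    rank_eq_of_unitLower _ (fun i => by rw [hN i i le_rfl, if_pos rfl])
      (fun i j hij => by rw [hN i j (le_of_lt hij), if_neg (ne_of_lt hij)])
  calc k + 1 = ((Matrix.of fun i a => v i a : Matrix (Fin (k + 1)) (Fin m) (ZMod p)) * M *
        (Matrix.of fun a j => u j a : Matrix (Fin m) (Fin (k + 1)) (ZMod p))).rank := hrk.symm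
    _ ≤ ((Matrix.of fun i a => v i a : Matrix (Fin (k + 1)) (Fin m) (ZMod p)) * M).rank :=
        Matrix.rank_mul_le_left _ _
    _ ≤ M.rank := Matrix.rank_mul_le_right _ _

/-- **NO LEVEL-`k` IDENTITY TEST ON `S ⊇ 1 + 𝔫` WHEN `(𝔫, λ)` CARRIES A RANK-ONE TRIANGULAR CONFIGURATION OF
SIZE `k + 1`.**  (`S` arbitrary; `{1 + T e}` need not be a group.) -/
theorem no_idTest_of_rankOneTriangle (k : ℕ) (T : CMat p m →+ CMat p m) (lam : CMat p m →+ ZMod p)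
    (u v : Fin (k + 1) → Fin m → ZMod p)
    (hconf : ∀ i j : Fin (k + 1), i ≤ j → ∃ e : CMat p m,
      T e = Matrix.vecMulVec (u j) (v i) ∧ lam (T e) = if i = j then 1 else 0)
    (S : Set (CMat p m)) (hS : ∀ e : CMat p m, 1 + T e ∈ S)
    (c : CMat p m → ℂ) (hc : ∀ M : CMat p m, k < M.rank → c M = 0)
    (h1 : fourierMat c 1 = 1) (h0 : ∀ s ∈ S, s ≠ 1 → fourierMat c s = 0) : False := by
  refine no_idTest_of_affineDual k T lam ?_ S hS c hc h1 h0
  intro M hM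
  by_contra hall
  push Not at hall
  have := succ_le_rank_of_rankOneTriangle T lam u v hconf M hall
  omega

/-! ## The pattern instance: a position set containing a transposed `(k+1)`-triangle -/

/-- On the affine dual coset of the grid form `λ(n) = Σ_l n_{γ l, ρ l}` of a position set containing the
transposed triangle `{(γ j, ρ i) : i ≤ j}`, every matrix has `M.submatrix ρ γ` lower unitriangular, hence rank
`≥ k + 1`. -/
theorem succ_le_rank_of_triCoset {k : ℕ} (Pos : Finset (Fin m × Fin m)) (ρ γ : Fin (k + 1) → Fin m)
    (hρ : Function.Injective ρ) (hγ : Function.Injective γ) (htri : ∀ i j, i ≤ j → (γ j, ρ i) ∈ Pos)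
    (M : CMat p m)
    (hM : ∀ e : CMat p m,
      Matrix.trace (M * (Matrix.of fun a b => if (a, b) ∈ Pos then e a b else 0)) =
        ∑ l : Fin (k + 1), (Matrix.of fun a b => if (a, b) ∈ Pos then e a b else 0 : CMat p m) (γ l) (ρ l)) :
    k + 1 ≤ M.rank := by
  have hentry : ∀ i j : Fin (k + 1), i ≤ j → M (ρ i) (γ j) = if i = j then 1 else 0 := by
    intro i j hij
    have h := hM (Matrix.of fun a b => if a = γ j ∧ b = ρ i then (1 : ZMod p) else 0)
    have hT : (Matrix.of fun a b => if (a, b) ∈ Pos then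
        (Matrix.of fun a b => if a = γ j ∧ b = ρ i then (1 : ZMod p) else 0 : CMat p m) a b else 0 : CMat p m) =
        Matrix.of fun a b => if a = γ j ∧ b = ρ i then (1 : ZMod p) else 0 := by
      ext a b
      simp only [Matrix.of_apply]
      by_cases hab : a = γ j ∧ b = ρ i
      · obtain ⟨rfl, rfl⟩ := hab
        rw [if_pos (htri i j hij)]
      · rw [if_neg hab]
        split_ifs <;> rfl
    rw [hT, trace_mul_elem, gridForm_elem ρ γ hρ hγ] at h
    exact h
  have hrk : (M.submatrix ρ γ).rank = k + 1 :=
    rank_eq_of_unitLower (M.submatrix ρ γ)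
      (fun i => by rw [Matrix.submatrix_apply, hentry i i le_rfl, if_pos rfl])
      (fun i j hij => by rw [Matrix.submatrix_apply, hentry i j (le_of_lt hij), if_neg (ne_of_lt hij)])
  calc k + 1 = (M.submatrix ρ γ).rank := hrk.symm
    _ ≤ M.rank := Matrix.rank_submatrix_le M ρ γ

/-- **NO LEVEL-`k` IDENTITY TEST ON A SET CONTAINING THE PATTERN POINTS `1 + n_e` OF A POSITION SET WITH A
TRANSPOSED `(k+1)`-TRIANGLE.** -/
theorem no_idTest_of_patTriangle (k : ℕ) (Pos : Finset (Fin m × Fin m)) (ρ γ : Fin (k + 1) → Fin m)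
    (hρ : Function.Injective ρ) (hγ : Function.Injective γ) (htri : ∀ i j, i ≤ j → (γ j, ρ i) ∈ Pos)
    (S : Set (CMat p m))
    (hS : ∀ e : CMat p m, 1 + (Matrix.of fun a b => if (a, b) ∈ Pos then e a b else 0 : CMat p m) ∈ S)
    (c : CMat p m → ℂ) (hc : ∀ M : CMat p m, k < M.rank → c M = 0)
    (h1 : fourierMat c 1 = 1) (h0 : ∀ s ∈ S, s ≠ 1 → fourierMat c s = 0) : False := by
  let T : CMat p m →+ CMat p m := AddMonoidHom.mk'
    (fun e : CMat p m => (Matrix.of fun a b => if (a, b) ∈ Pos then e a b else 0 : CMat p m)) (by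
      intro x y
      ext a b
      simp only [Matrix.of_apply, Matrix.add_apply]
      split_ifs <;> simp)
  let lam : CMat p m →+ ZMod p := AddMonoidHom.mk'
    (fun n : CMat p m => ∑ l : Fin (k + 1), n (γ l) (ρ l)) (by
      intro x y
      simp [Finset.sum_add_distrib])
  have hT : ∀ e, T e = (Matrix.of fun a b => if (a, b) ∈ Pos then e a b else 0 : CMat p m) := fun e => rfl
  have hlam : ∀ n, lam n = ∑ l : Fin (k + 1), n (γ l) (ρ l) := fun n => rfl
  refine no_idTest_of_affineDual k T lam ?_ S (fun e => by rw [hT]; exact hS e) c hc h1 h0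
  intro M hM
  by_contra hall
  push Not at hall
  have := succ_le_rank_of_triCoset Pos ρ γ hρ hγ htri M (fun e => by rw [← hT, ← hlam]; exact hall e)
  omega

/-- `det (1 + n_e) = 1` when `Pos` is strictly upper triangular. -/
theorem det_one_add_patUpp (Pos : Finset (Fin m × Fin m)) (hupp : ∀ ab ∈ Pos, ab.1.val < ab.2.val)
    (e : CMat p m) :
    (1 + (Matrix.of fun a b => if (a, b) ∈ Pos then e a b else 0 : CMat p m)).det = 1 := by
  have hz : ∀ a b : Fin m, b.val ≤ a.val →
      (Matrix.of fun a b => if (a, b) ∈ Pos then e a b else 0 : CMat p m) a b = 0 := by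
    intro a b hab
    simp only [Matrix.of_apply]
    rw [if_neg]
    intro hmem
    have := hupp _ hmem
    simp only at this
    omega
  have htri : (1 + (Matrix.of fun a b => if (a, b) ∈ Pos then e a b else 0 : CMat p m)).BlockTriangular
      id := by
    intro a b hlt
    have hlt' : b < a := by simpa using hlt
    rw [Matrix.add_apply, Matrix.one_apply_ne (ne_of_gt hlt'), hz a b (le_of_lt hlt'), add_zero]
  rw [Matrix.det_of_upperTriangular htri]
  refine Finset.prod_eq_one fun a _ => ?_
  rw [Matrix.add_apply, Matrix.one_apply_eq, hz a a le_rfl, add_zero]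

/-- Design filter, common part: `Pos` arbitrary but every `1 + n_e` invertible. -/
theorem no_levelK_design_of_patTriangle_det (k : ℕ) (Pos : Finset (Fin m × Fin m))
    (hdet : ∀ e : CMat p m, (1 + (Matrix.of fun a b => if (a, b) ∈ Pos then e a b else 0 : CMat p m)).det ≠ 0)
    (ρ γ : Fin (k + 1) → Fin m)
    (hρ : Function.Injective ρ) (hγ : Function.Injective γ) (htri : ∀ i j, i ≤ j → (γ j, ρ i) ∈ Pos)
    {H₁ H₂ H₃ : Subgroup (Matrix.GeneralLinearGroup (Fin m) (ZMod p))}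
    (hQ : ∀ u : Matrix.GeneralLinearGroup (Fin m) (ZMod p),
      (∀ a b : Fin m, ((u : CMat p m) - 1) a b ≠ 0 → (a, b) ∈ Pos) → u ∈ H₁)
    (hid : ∃ c : CMat p m → ℂ, (∀ M : CMat p m, k < M.rank → c M = 0) ∧
      (∑ M : CMat p m, c M * ZMod.stdAddChar (Matrix.trace
        (M * ((1 : Matrix.GeneralLinearGroup (Fin m) (ZMod p)) : CMat p m)))) = 1 ∧
      ∀ a ∈ H₁, ∀ b ∈ H₂, ∀ g ∈ H₃, a * b * g ≠ 1 →
        (∑ M : CMat p m, c M * ZMod.stdAddChar (Matrix.trace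
          (M * ((a * b * g : Matrix.GeneralLinearGroup (Fin m) (ZMod p)) : CMat p m)))) = 0) :
    False := by
  obtain ⟨c, hc, h1, h0⟩ := hid
  let S : Set (CMat p m) := {s | ∃ a ∈ H₁, ∃ b ∈ H₂, ∃ g ∈ H₃,
    s = ((a * b * g : Matrix.GeneralLinearGroup (Fin m) (ZMod p)) : CMat p m)}
  refine no_idTest_of_patTriangle k Pos ρ γ hρ hγ htri S ?_ c hc ?_ ?_
  · intro e
    let u : Matrix.GeneralLinearGroup (Fin m) (ZMod p) :=
      Matrix.GeneralLinearGroup.mkOfDetNeZero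
        (1 + (Matrix.of fun a b => if (a, b) ∈ Pos then e a b else 0 : CMat p m)) (hdet e)
    have hu : (u : CMat p m) = 1 + (Matrix.of fun a b => if (a, b) ∈ Pos then e a b else 0 : CMat p m) :=
      rfl
    have huH : u ∈ H₁ := by
      refine hQ u fun a b hab => ?_
      rw [hu, add_sub_cancel_left] at hab
      simp only [Matrix.of_apply] at hab
      by_contra hmem
      exact hab (if_neg hmem)
    refine ⟨u, huH, 1, H₂.one_mem, 1, H₃.one_mem, ?_⟩
    rw [mul_one, mul_one, hu]
  · simpa [fourierMat] using h1
  · rintro s ⟨a, ha, b, hb, g, hg, rfl⟩ hs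
    refine h0 a ha b hb g hg fun h => hs ?_
    rw [h, Matrix.GeneralLinearGroup.coe_one]

/-- **DESIGN FILTER (transposed triangle, strictly lower pattern).**  In `GL_m(𝔽_p)`: if `H₁` contains every
unipotent `u` with `u − 1` supported on a strictly-lower position set `Pos` containing a transposed
`(k+1)`-triangle `{(γ j, ρ i) : i ≤ j}` (`ρ, γ` injective), then `(H₁, H₂, H₃)` admits NO level-`k` identity
design, whatever `H₂, H₃` and the prime `p`. -/
theorem no_levelK_design_of_patTriangle (k : ℕ) (Pos : Finset (Fin m × Fin m))
    (hlow : ∀ ab ∈ Pos, ab.2.val < ab.1.val) (ρ γ : Fin (k + 1) → Fin m)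
    (hρ : Function.Injective ρ) (hγ : Function.Injective γ) (htri : ∀ i j, i ≤ j → (γ j, ρ i) ∈ Pos)
    {H₁ H₂ H₃ : Subgroup (Matrix.GeneralLinearGroup (Fin m) (ZMod p))}
    (hQ : ∀ u : Matrix.GeneralLinearGroup (Fin m) (ZMod p),
      (∀ a b : Fin m, ((u : CMat p m) - 1) a b ≠ 0 → (a, b) ∈ Pos) → u ∈ H₁)
    (hid : ∃ c : CMat p m → ℂ, (∀ M : CMat p m, k < M.rank → c M = 0) ∧
      (∑ M : CMat p m, c M * ZMod.stdAddChar (Matrix.trace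
        (M * ((1 : Matrix.GeneralLinearGroup (Fin m) (ZMod p)) : CMat p m)))) = 1 ∧
      ∀ a ∈ H₁, ∀ b ∈ H₂, ∀ g ∈ H₃, a * b * g ≠ 1 →
        (∑ M : CMat p m, c M * ZMod.stdAddChar (Matrix.trace
          (M * ((a * b * g : Matrix.GeneralLinearGroup (Fin m) (ZMod p)) : CMat p m)))) = 0) :
    False :=
  no_levelK_design_of_patTriangle_det k Pos
    (fun e => by rw [det_one_add_patLow Pos hlow]; exact one_ne_zero) ρ γ hρ hγ htri hQ hid

/-- **DESIGN FILTER (transposed triangle, strictly upper pattern).** -/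
theorem no_levelK_design_of_patTriangleUpper (k : ℕ) (Pos : Finset (Fin m × Fin m))
    (hupp : ∀ ab ∈ Pos, ab.1.val < ab.2.val) (ρ γ : Fin (k + 1) → Fin m)
    (hρ : Function.Injective ρ) (hγ : Function.Injective γ) (htri : ∀ i j, i ≤ j → (γ j, ρ i) ∈ Pos)
    {H₁ H₂ H₃ : Subgroup (Matrix.GeneralLinearGroup (Fin m) (ZMod p))}
    (hQ : ∀ u : Matrix.GeneralLinearGroup (Fin m) (ZMod p),
      (∀ a b : Fin m, ((u : CMat p m) - 1) a b ≠ 0 → (a, b) ∈ Pos) → u ∈ H₁)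
    (hid : ∃ c : CMat p m → ℂ, (∀ M : CMat p m, k < M.rank → c M = 0) ∧
      (∑ M : CMat p m, c M * ZMod.stdAddChar (Matrix.trace
        (M * ((1 : Matrix.GeneralLinearGroup (Fin m) (ZMod p)) : CMat p m)))) = 1 ∧
      ∀ a ∈ H₁, ∀ b ∈ H₂, ∀ g ∈ H₃, a * b * g ≠ 1 →
        (∑ M : CMat p m, c M * ZMod.stdAddChar (Matrix.trace
          (M * ((a * b * g : Matrix.GeneralLinearGroup (Fin m) (ZMod p)) : CMat p m)))) = 0) :
    False :=
  no_levelK_design_of_patTriangle_det k Pos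
    (fun e => by rw [det_one_add_patUpp Pos hupp]; exact one_ne_zero) ρ γ hρ hγ htri hQ hid

/-- **COROLLARY (lower unitriangular group).**  If `m ≥ k + 2` and `H₁` contains every unipotent supported
strictly below the diagonal, there is no level-`k` identity design: the strictly-lower positions contain the
transposed staircase `(j + 1, i)`, `i ≤ j ≤ k`. -/
theorem no_levelK_design_of_lowerUnitriangular (k : ℕ) (hkm : k + 2 ≤ m)
    {H₁ H₂ H₃ : Subgroup (Matrix.GeneralLinearGroup (Fin m) (ZMod p))}
    (hQ : ∀ u : Matrix.GeneralLinearGroup (Fin m) (ZMod p),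
      (∀ a b : Fin m, ((u : CMat p m) - 1) a b ≠ 0 → b.val < a.val) → u ∈ H₁)
    (hid : ∃ c : CMat p m → ℂ, (∀ M : CMat p m, k < M.rank → c M = 0) ∧
      (∑ M : CMat p m, c M * ZMod.stdAddChar (Matrix.trace
        (M * ((1 : Matrix.GeneralLinearGroup (Fin m) (ZMod p)) : CMat p m)))) = 1 ∧
      ∀ a ∈ H₁, ∀ b ∈ H₂, ∀ g ∈ H₃, a * b * g ≠ 1 →
        (∑ M : CMat p m, c M * ZMod.stdAddChar (Matrix.trace
          (M * ((a * b * g : Matrix.GeneralLinearGroup (Fin m) (ZMod p)) : CMat p m)))) = 0) :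
    False := by
  let Pos : Finset (Fin m × Fin m) := Finset.univ.filter fun ab => ab.2.val < ab.1.val
  let ρ : Fin (k + 1) → Fin m := fun i => ⟨i.val, by omega⟩
  let γ : Fin (k + 1) → Fin m := fun j => ⟨j.val + 1, by omega⟩
  have hPos : ∀ ab : Fin m × Fin m, ab ∈ Pos ↔ ab.2.val < ab.1.val := fun ab => by simp [Pos]
  refine no_levelK_design_of_patTriangle k Pos (fun ab hab => (hPos ab).1 hab) ρ γ ?_ ?_ ?_
    (fun u hu => hQ u fun a b hab => (hPos _).1 (hu a b hab)) hid
  · intro i j h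
    have h' : i.val = j.val := by simpa [ρ] using congrArg Fin.val h
    exact Fin.ext h'
  · intro i j h
    have h' : i.val + 1 = j.val + 1 := by simpa [γ] using congrArg Fin.val h
    exact Fin.ext (by omega)
  · intro i j hij
    rw [hPos]
    show i.val < j.val + 1
    exact Nat.lt_succ_of_le hij

/-- **COROLLARY (upper unitriangular group; re-derives `Negative.UnitriangularLevel`'s filter).**  If
`m ≥ k + 2` and `H₁` contains every unipotent supported strictly above the diagonal (i.e. `H₁ ⊇ U_m`), there is
no level-`k` identity design: the strictly-upper positions contain the transposed reversed staircase
`(k − j, k + 1 − i)`, `i ≤ j ≤ k`. -/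
theorem no_levelK_design_of_upperUnitriangular (k : ℕ) (hkm : k + 2 ≤ m)
    {H₁ H₂ H₃ : Subgroup (Matrix.GeneralLinearGroup (Fin m) (ZMod p))}
    (hQ : ∀ u : Matrix.GeneralLinearGroup (Fin m) (ZMod p),
      (∀ a b : Fin m, ((u : CMat p m) - 1) a b ≠ 0 → a.val < b.val) → u ∈ H₁)
    (hid : ∃ c : CMat p m → ℂ, (∀ M : CMat p m, k < M.rank → c M = 0) ∧
      (∑ M : CMat p m, c M * ZMod.stdAddChar (Matrix.trace
        (M * ((1 : Matrix.GeneralLinearGroup (Fin m) (ZMod p)) : CMat p m)))) = 1 ∧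
      ∀ a ∈ H₁, ∀ b ∈ H₂, ∀ g ∈ H₃, a * b * g ≠ 1 →
        (∑ M : CMat p m, c M * ZMod.stdAddChar (Matrix.trace
          (M * ((a * b * g : Matrix.GeneralLinearGroup (Fin m) (ZMod p)) : CMat p m)))) = 0) :
    False := by
  let Pos : Finset (Fin m × Fin m) := Finset.univ.filter fun ab => ab.1.val < ab.2.val
  let ρ : Fin (k + 1) → Fin m := fun i => ⟨k + 1 - i.val, by omega⟩
  let γ : Fin (k + 1) → Fin m := fun j => ⟨k - j.val, by omega⟩
  have hPos : ∀ ab : Fin m × Fin m, ab ∈ Pos ↔ ab.1.val < ab.2.val := fun ab => by simp [Pos]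
  refine no_levelK_design_of_patTriangleUpper k Pos (fun ab hab => (hPos ab).1 hab) ρ γ ?_ ?_ ?_
    (fun u hu => hQ u fun a b hab => (hPos _).1 (hu a b hab)) hid
  · intro i j h
    have h' : k + 1 - i.val = k + 1 - j.val := by simpa [ρ] using congrArg Fin.val h
    exact Fin.ext (by omega)
  · intro i j h
    have h' : k - i.val = k - j.val := by simpa [γ] using congrArg Fin.val h
    exact Fin.ext (by omega)
  · intro i j hij
    rw [hPos]
    show k - j.val < k + 1 - i.val
    have : i.val ≤ j.val := hij
    omega

end Summit.MatrixMultiplication.MatrixMultiplication.Theorems.SubgroupIdentityDesigns.Negative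

end
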